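import Summits.AtomisticToContinuum.BoseEinsteinCondensation.Theorems.BECThomsonPrincipleGDTransferSeededDefs
import Summits.AtomisticToContinuum.BoseEinsteinCondensation.Theorems.BECInsertionCorrectorCorrectorClosureVolumeBootstrap

/-!
# Route `BECThomsonPrinciple`, crux `GDTransfer` (stmt-AtomisticToContinuum-9482), line `seeded-continuity` —
# registered stub `stub_freeCorner`: the free corner

Supports (does not close) stmt-AtomisticToContinuum-9482.

**Statement** (`FreeCorner v` for every repulsive finite-range `v`). For every `ε > 0` there are `A > 0` and
`N₀` such that on every box of side `L ≥ A·N` with `N ≥ N₀` some slack `δ > 0` makes every `δ`-near-minimiser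
of the periodic `N`-body energy `ε`-completely condensed: `N ≤ ⟨n̂₀⟩ + εN`.

**Proof** (the near-minimiser version of the dilute anchor `vb_anchor`). The depletion is controlled by the
kinetic energy, `N − n₀ = Σ_{k≠0} n_k ≤ (L/2π)² Σ_k |k|² n_k = (L/2π)² ∫|∇Ψ|² ≤ (L/2π)² E(Ψ)`
(`vb_depletion_le`: Parseval and the kinetic Chebyshev bound `|k| ≥ 2π/L` for `k ≠ 0`;
`lintegral_kineticDensity_le_periodicEnergy`), and `E(Ψ) ≤ E₀(N, L) + δ ≤ 16πR (N/L³) N + δ` for `N ≥ 2`,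
`L > 4R`, `N/L³ < ρ₁(R)` (`dud_groundStateEnergy_le`, the Dyson–LSSY upper bound in `(N, L)`-form). With the
slack `δ := (ε/2) N (2π/L)²` this gives `N − n₀ ≤ 4RN²/(πL) + εN/2 ≤ εN` once `πεL ≥ 8RN`. Constants:
`R := max R₀ 1`, `A := max (4R + 1) (max (8R/(πε)) (1/ρ₁ + 1))`, `N₀ := 2`.

## References

* [LSSY2005] E. H. Lieb, R. Seiringer, J. P. Solovej, J. Yngvason, *The Mathematics of the Bose Gas and
  its Condensation*, Birkhäuser (2005): Thm 2.2 (2.14); App. A (A.6), (A.10), (A.11).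
-/

noncomputable section

open MeasureTheory Filter Set Metric
open scoped ENNReal NNReal

namespace Summit.AtomisticToContinuum.BoseEinsteinCondensation.Cruxes.GDTransfer.Seeded

open Literature.MathematicalPhysics.QuantumManyBody.BoseGas
open Summit.AtomisticToContinuum.BoseEinsteinCondensation.Theses.BECThomsonPrinciple
open Summit.AtomisticToContinuum.BoseEinsteinCondensation.Theorems.CorrectorClosure.VolumeHomotopySumRuleDomination
  (vb_depletion_le dud_groundStateEnergy_le)

/-! ## The free corner in `(N, L)`-form -/

/-- **The free corner, `(N, L)`-form.** For a finite-range `v` and `ε > 0` there is `A > 0` such that for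
every `N ≥ 2` and every side `L ≥ A·N` some slack `δ > 0` makes every `δ`-near-minimiser of the periodic
`N`-body energy `ε`-completely condensed, `N ≤ n₀ + εN`: `N − n₀ ≤ (L/2π)² E(Ψ)` (`vb_depletion_le`),
`E(Ψ) ≤ E₀ + δ ≤ 16πR (N/L³) N + δ` (`dud_groundStateEnergy_le`), `δ := (ε/2) N (2π/L)²`, and
`4RN²/(πL) ≤ εN/2` for `πεL ≥ 8RN`. [cite: LSSY2005, Thm 2.2 (2.14); App. A (A.6), (A.10), (A.11)] -/
theorem freeCorner_nat {v : ℝ → ℝ≥0∞} (hv : IsRepulsiveFiniteRange v) {ε : ℝ} (hε : 0 < ε) :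
    ∃ A : ℝ, 0 < A ∧ ∀ N : ℕ, 2 ≤ N → ∀ L : ℝ, A * N ≤ L →
      ∃ δ : ℝ≥0∞, 0 < δ ∧ ∀ Ψ : PeriodicTrialState N L,
        periodicEnergy v Ψ ≤ periodicGroundStateEnergy v N L + δ →
        (N : ℝ≥0∞) ≤ condensateOccupation N L Ψ.ψ + ENNReal.ofReal (ε * N) := by
  obtain ⟨-, R₀, hR₀⟩ := hv
  set R := max R₀ 1 with hR
  have hRpos : 0 < R := lt_max_of_lt_right one_pos
  have hvR : ∀ r, R < r → v r = 0 := fun r hr => hR₀ r ((le_max_left _ _).trans_lt hr)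
  obtain ⟨ρ₁, hρ₁, hbud⟩ := dud_groundStateEnergy_le hRpos
  have hApos : 0 < max (4 * R + 1) (max (8 * R / (Real.pi * ε)) (1 / ρ₁ + 1)) := by positivity
  refine ⟨max (4 * R + 1) (max (8 * R / (Real.pi * ε)) (1 / ρ₁ + 1)), hApos, fun N hN L hL => ?_⟩
  have hNpos : 0 < N := by omega
  have hN1 : (1 : ℝ) ≤ N := by exact_mod_cast hNpos
  have hN0 : (0 : ℝ) < N := by linarith
  -- `A ≤ A·N ≤ L`, so `L > 4R`, `L ≥ 1`, `πεL ≥ 8RN`, `N/L³ < ρ₁`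
  have hAL : max (4 * R + 1) (max (8 * R / (Real.pi * ε)) (1 / ρ₁ + 1)) ≤ L :=
    (le_mul_of_one_le_right hApos.le hN1).trans hL
  have hL1 : 4 * R + 1 ≤ L := (le_max_left _ _).trans hAL
  have hL2 : 8 * R / (Real.pi * ε) * N ≤ L :=
    (mul_le_mul_of_nonneg_right ((le_max_left _ _).trans (le_max_right _ _)) hN0.le).trans hL
  have hL3 : (1 / ρ₁ + 1) * N ≤ L :=
    (mul_le_mul_of_nonneg_right ((le_max_right _ _).trans (le_max_right _ _)) hN0.le).trans hL
  have hL0 : 0 < L := by linarith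
  have hLone : 1 ≤ L := by linarith
  have hπL : 8 * R * N ≤ Real.pi * ε * L := by
    rw [div_mul_eq_mul_div, div_le_iff₀ (by positivity)] at hL2
    linarith
  have hρ : (N : ℝ) / L ^ 3 < ρ₁ := by
    rw [div_lt_iff₀ (by positivity)]
    have h1 : (N : ℝ) / ρ₁ < L := by
      have : (1 / ρ₁ + 1) * N = N / ρ₁ + N := by ring
      linarith
    rw [div_lt_iff₀ hρ₁] at h1
    have h2 : L ≤ L ^ 3 := by
      calc L = L ^ 1 := (pow_one L).symm
        _ ≤ L ^ 3 := pow_le_pow_right₀ hLone (by norm_num)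
    calc (N : ℝ) < L * ρ₁ := h1
      _ ≤ L ^ 3 * ρ₁ := by gcongr
      _ = ρ₁ * L ^ 3 := mul_comm _ _
  have hE := hbud N hN L (by linarith) hρ v hvR
  -- the slack `δ := (ε/2) N (2π/L)²`
  refine ⟨ENNReal.ofReal (ε / 2 * N * (2 * Real.pi / L) ^ 2), ENNReal.ofReal_pos.2 (by positivity),
    fun Ψ hΨ => ?_⟩
  -- the energy budget `E(Ψ) ≤ B := 16πR (N/L³) N + δ`, with `(L/2π)² B ≤ εN`
  set B : ℝ := 16 * Real.pi * R * ((N : ℝ) / L ^ 3) * N + ε / 2 * N * (2 * Real.pi / L) ^ 2 with hB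
  have hΨB : periodicEnergy v Ψ ≤ ENNReal.ofReal B := by
    calc periodicEnergy v Ψ
        ≤ periodicGroundStateEnergy v N L + ENNReal.ofReal (ε / 2 * N * (2 * Real.pi / L) ^ 2) := hΨ
      _ ≤ ENNReal.ofReal (16 * Real.pi * R * ((N : ℝ) / L ^ 3) * N) +
          ENNReal.ofReal (ε / 2 * N * (2 * Real.pi / L) ^ 2) := add_le_add hE le_rfl
      _ = ENNReal.ofReal B := by
          rw [hB, ← ENNReal.ofReal_add (by positivity) (by positivity)]
  have hBL : (L / (2 * Real.pi)) ^ 2 * B ≤ ε * N := by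
    have hmain : 4 * R * (N : ℝ) ^ 2 / (Real.pi * L) ≤ ε / 2 * N := by
      rw [div_le_iff₀ (by positivity)]
      calc 4 * R * (N : ℝ) ^ 2 = (N : ℝ) * (8 * R * N) / 2 := by ring
        _ ≤ (N : ℝ) * (Real.pi * ε * L) / 2 := by gcongr
        _ = ε / 2 * N * (Real.pi * L) := by ring
    rw [hB, show (L / (2 * Real.pi)) ^ 2 * (16 * Real.pi * R * ((N : ℝ) / L ^ 3) * N +
        ε / 2 * N * (2 * Real.pi / L) ^ 2) = 4 * R * (N : ℝ) ^ 2 / (Real.pi * L) + ε / 2 * N by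
        field_simp; ring]
    linarith
  -- depletion `N − n₀ ≤ (L/2π)² ∫|∇Ψ|² ≤ (L/2π)² E(Ψ) ≤ (L/2π)² B ≤ εN`
  have h1 : (N : ℝ≥0∞) - condensateOccupation N L Ψ.ψ ≤ ENNReal.ofReal (ε * N) := by
    calc (N : ℝ≥0∞) - condensateOccupation N L Ψ.ψ
        ≤ ENNReal.ofReal ((L / (2 * Real.pi)) ^ 2) * ∫⁻ X in cellN N L, kineticDensity Ψ.ψ X :=
          vb_depletion_le hL0 Ψ
      _ ≤ ENNReal.ofReal ((L / (2 * Real.pi)) ^ 2) * periodicEnergy v Ψ :=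
          mul_le_mul' le_rfl (lintegral_kineticDensity_le_periodicEnergy v Ψ)
      _ ≤ ENNReal.ofReal ((L / (2 * Real.pi)) ^ 2) * ENNReal.ofReal B := mul_le_mul' le_rfl hΨB
      _ = ENNReal.ofReal ((L / (2 * Real.pi)) ^ 2 * B) := (ENNReal.ofReal_mul (sq_nonneg _)).symm
      _ ≤ ENNReal.ofReal (ε * N) := ENNReal.ofReal_le_ofReal hBL
  exact (tsub_le_iff_right.mp h1).trans_eq (add_comm _ _)

/-! ## The registered stub -/

/-- **Registered stub `stub_freeCorner`** (line `seeded-continuity` of crux `GDTransfer`,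
stmt-AtomisticToContinuum-9482): the free corner `FreeCorner v` for every repulsive finite-range `v` — for
every `ε > 0` there are `A > 0` and `N₀ := 2` such that on every box of side `L ≥ A·N`, `N ≥ N₀`, some slack
`δ > 0` makes every `δ`-near-minimiser `ε`-completely condensed (`freeCorner_nat` at `N = m + 1`).
[cite: LSSY2005, Thm 2.2 (2.14); App. A (A.6), (A.10), (A.11)] -/
theorem stub_freeCorner : Sig.stub_freeCorner := by
  intro v hv ε hε
  obtain ⟨A, hA, h⟩ := freeCorner_nat hv hε
  refine ⟨A, hA, 2, fun m hm L hL => ?_⟩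
  obtain ⟨δ, hδ, hΨ⟩ := h (m + 1) hm L (by exact_mod_cast hL)
  refine ⟨δ, hδ, fun Ψ hle => ?_⟩
  have h1 := hΨ Ψ hle
  exact_mod_cast h1

end Summit.AtomisticToContinuum.BoseEinsteinCondensation.Cruxes.GDTransfer.Seeded

end
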